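import Summits.BirchSwinnertonDyer.BirchSwinnertonDyer.Theorems.AdditiveKolyvaginRoadInductionOfLevelSystemsLocalGlobal
import HarnessLib

/-!
# Route `AdditiveKolyvaginRoad`, crux `KolyvaginPrimitiveAdditive` (item stmt-BirchSwinnertonDyer-20132):
# stub ENGINE `stub_inductionOfLevelSystemsAdditive` of the registered skeleton (line `birth`, v7.1, sha16 72123bc6) —
# PROVED (cell `pub/bsd-wall`, lead prover `bsd-wall-akr-p1` g3; `--supports stmt-BirchSwinnertonDyer-20132`, stub ENGINE)

`stub_inductionOfLevelSystemsAdditive` — **W. ZHANG'S §9 INDUCTION ABOVE THE BOTTOM AT AN ADDITIVE PRIME `p ≥ 5`**, the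
registered stub-ENGINE text VERBATIM and UNCONDITIONAL: at every ♯ additive frame of crux 20132, for complex conjugation
`c ≠ 1` and the `ZMod p`-structures of `H¹(K, E[p])` and of the `H¹(K_v, E[p])`, the (A1) rank lowering at the frame
(hypothesis; the body of the LANDED stub A1, p521749), a `LevelKolyvaginSystemP` (the KS-datum of stub KS: W. Zhang's
level Kolyvagin systems), a `KolyvaginLocalPackageP` (the LOC-datum of stub LOC: the local–global package) and
`#Sel_p(E/K) = p^s` with `s` odd `≥ 3` give a Kolyvagin–Heegner datum of Kolyvagin-prime support with non-zero class
`c_1(n) mod p` — the crux's conclusion. Proof: `inductionOfLevelSystemsP_of_localPackage` (the three p-generic layers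
`AdditiveKolyvaginRoadInductionOfLevelSystems{,Dict,LocalGlobal}` over the tree's p-uniform engine-of-KS
`ZhangTriangulation.exists_ne_zero_of_zhangInduction_on_of_kolyvaginSystem_finite_oddStart`, the membership and per-place
dictionaries, (Cheb) ×2 from McCallum's Cor. 3.2) after translating `Nat.card (Sel_p(E/K)) = p^s` into
`dim_𝔽_p Sel_p(E/K) = s` (akr-p1 g2's `natCard_selmer_eq_pow_finrank_selQP_add` ∕ `finrank_selmer_eq_finrank_selQP_add`).
The frame hypotheses used: `5 ≤ p` (so `p ≠ 2`), `ρ̄_{E,p}` onto, `K` imaginary quadratic; the rest are carried.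

HONEST FRAMING: one theorem; no definition, no named fact, no `sorry`; closes stub ENGINE of crux 20132 only (the crux
stays open: stubs BOT, KS, LOC and the PUB-conditional P remain).

References: [cite: WZhang2014, §9 proof of Thm. 9.1, Lemma 8.4, §8.1, Thm. 9.2] [cite: McCallumLMS1991, Prop. 3.1,
Cor. 3.2, Lemma 5.3] [cite: MilneADT2006, Ch. I, Thm. 4.10] [cite: GrossLMS1991, §3, §10].
-/

-- single-conjunct summit: `Summit.BirchSwinnertonDyer.BirchSwinnertonDyer.…` repeats the name by design
set_option linter.dupNamespace false

noncomputable section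

open scoped Classical

namespace Summit.BirchSwinnertonDyer.BirchSwinnertonDyer.Theorems.AdditiveKoly

open WeierstrassCurve NumberField IsDedekindDomain
  Literature.NumberTheory.EllipticCurves Literature.NumberTheory.EllipticCurves.ModularForms
  Literature.NumberTheory.EllipticCurves.Rank1Residual Literature.NumberTheory.GaloisRepresentations Module

/-- **Stub ENGINE of crux 20132 (skeleton v7.1), PROVED: W. Zhang's §9 induction above the bottom at an additive prime
`p ≥ 5`.** At every ♯ additive frame, for `c ≠ 1` and the `ZMod p`-structures: (A1) at the frame (hypothesis), a
`LevelKolyvaginSystemP`, a `KolyvaginLocalPackageP` and `#Sel_p(E/K) = p^s` with `s` odd `≥ 3` ⟹ some Kolyvagin–Heegner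
datum of Kolyvagin-prime support has non-zero class mod `p`. Registered signature verbatim.
[cite: WZhang2014, §9 proof of Thm. 9.1, Lemma 8.4, §8.1] [cite: McCallumLMS1991, Cor. 3.2] -/
theorem stub_inductionOfLevelSystemsAdditive :
  ∀ (W : WeierstrassCurve ℚ) [W.IsElliptic] [W.IsGloballyMinimal] [NeZero (W.conductorNorm ℤ)]
    (p : ℕ) [Fact p.Prime] (K : Type) [Field K] [NumberField K]
    (Dt : ModularParametrizationData W (W.conductorNorm ℤ)) (β : ℤ) (ι : K →+* ℂ),
    5 ≤ p → Addv W p → W.HasSurjectiveModNGaloisRep p →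
    (∀ (ℓ : ℕ) [Fact ℓ.Prime], W.HasMultiplicativeReductionAtPrime ℓ →
      ¬ p ∣ padicValInt ℓ W.minimalDiscriminantInt) →
    (∃ (ℓ₁ ℓ₂ : ℕ) (_ : Fact ℓ₁.Prime) (_ : Fact ℓ₂.Prime), ℓ₁ ≠ ℓ₂ ∧
      W.HasMultiplicativeReductionAtPrime ℓ₁ ∧ W.HasMultiplicativeReductionAtPrime ℓ₂) →
    ¬ p ∣ W.tamagawaProduct → W.analyticRank = 1 →
    IsImaginaryQuadratic K → Odd (NumberField.discr K) →
    SatisfiesHeegnerHypothesis (W.conductorNorm ℤ) K →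
    (W.quadraticTwist (NumberField.discr K : ℚ)).entireLFunction 1 ≠ 0 →
    (4 * (W.conductorNorm ℤ : ℤ)) ∣ β ^ 2 - NumberField.discr K → ¬ (p : ℤ) ∣ Dt.c →
    ∀ (c : K ≃ₐ[ℚ] K), c ≠ 1 → ∀ [Module (ZMod p) (Vp W K p)]
      [∀ v : Place K, Module (ZMod p)
        (galoisCohomology (((W.baseChange K).torsionGaloisModule ((p ^ 1 : ℕ) : ℤ)).toLocal v) 1)],
      (∀ (n : Finset (AdmQ W K p)) (μ : Bool) (x : Vp W K p),
        x ∈ SelQP W K p c n μ → x ≠ 0 →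
        ∃ q : AdmQ W K p, q ∉ n ∧
          x ∉ SelQP W K p c (insert q n) μ ∧
          SelQP W K p c (insert q n) μ ≤ SelQP W K p c n μ ∧
          finrank (ZMod p) (SelQP W K p c (insert q n) μ) + 1 = finrank (ZMod p) (SelQP W K p c n μ) ∧
          SelQP W K p c (insert q n) (!μ) = SelQP W K p c n (!μ)) →
    LevelKolyvaginSystemP W K p Dt β ι c → KolyvaginLocalPackageP W K p ι c →
    ∀ (s : ℕ), Odd s → 3 ≤ s →
    Nat.card (WeierstrassCurve.selmerGroup (W.baseChange K) (p : ℤ)) = p ^ s →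
    ∃ (n : ℕ) (d : KolyvaginHeegnerData Dt β ι n),
      KolyvaginDescent.KolSupp (Zhang2014.IsKolyvaginPrime (W.conductorNorm ℤ) W K p) n ∧
        d.kolyvaginClass (Fact.out : p.Prime) 1 ≠ 0
    := by
  intro W _ _ _ p _ K _ _ Dt β ι h5 _ hsurj _ _ _ _ hK _ _ _ _ _ c hc1 _ _ hA1 S Lp s hsodd h3 hs
  have hp : p.Prime := Fact.out
  have hp2 : p ≠ 2 := by omega
  have hcc : c * c = 1 := Summit.BirchSwinnertonDyer.Rank1Residual.X11b.Three.Koly.Method2.algEquiv_mul_self_eq_one K hK c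
  -- `#Sel_p(E/K) = p ^ (dim⁺ + dim⁻)` and `= p ^ s`, so the total canonical rank at `∅` is `s`
  have hcard := natCard_selmer_eq_pow_finrank_selQP_add W K p hp2 hK c hcc
  have e1 : ((p ^ 1 : ℕ) : ℤ) = (p : ℤ) := by simp
  have hs' : Nat.card (selmerGroup (W.baseChange K) ((p ^ 1 : ℕ) : ℤ)) = p ^ s := by rw [e1]; exact hs
  rw [hcard] at hs'
  have hdim : finrank (ZMod p) (SelQP W K p c ∅ true) + finrank (ZMod p) (SelQP W K p c ∅ false) = s :=
    Nat.pow_right_injective hp.two_le hs'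
  have hfin : finrank (ZMod p)
      (AddSubgroup.toZModSubmodule p (selmerGroup (W.baseChange K) ((p ^ 1 : ℕ) : ℤ))) = s := by
    rw [finrank_selmer_eq_finrank_selQP_add W K p hp2 hK c hcc, hdim]
  exact inductionOfLevelSystemsP_of_localPackage W K p Dt β ι c hp2 hK hsurj hc1 S Lp hA1 (hfin ▸ hsodd)
    (hfin ▸ h3)

end Summit.BirchSwinnertonDyer.BirchSwinnertonDyer.Theorems.AdditiveKoly

end
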